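import Summits.CriticalPhenomena.Ising3DConformalLimit.Theses.AnomalousForcesInteraction
import Literature.Probability.LatticeModels.TwoPointSupNormMonotone
import Literature.Probability.LatticeModels.HighDimTrivialityUniformProofs
import Literature.Probability.LatticeModels.MessagerMiracleSole
import Literature.Probability.LatticeModels.SharpnessProofs
import Literature.Probability.LatticeModels.PointwiseScalingLimitEtaExists
import Literature.Probability.LatticeModels.CriticalScalingDimension
import HarnessLib

/-!
# Crux `EtaPositive` (stmt-CriticalPhenomena-2600) in finite-size-scaling form

Route `AnomalousForcesInteraction` (Ising3DConformalLimit). The crux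
`EtaPositive := ∃ κ > 0, C, ∀ x ≠ 0, ⟨σ₀σ_x⟩⁺_{β_c(3)} ≤ C ‖x‖^{-(1+κ)}` ("`η(3) > 0` in power upper-bound
form") is shown EQUIVALENT to a power gain on the box sums of the infinite-volume critical two-point
function over the infrared growth `L²`:

  `∃ κ > 0, C, ∀ L ≥ 1, Σ_{y ∈ Λ_L} ⟨σ₀σ_y⟩⁺_{β_c(3)} ≤ C L^{2-κ}`   (`Λ_L = [-L,L]³ ∩ ℤ³`),

i.e. the finite-size-scaling form `χ_L(β_c) ≲ L^{2-η}`, `η > 0`, in which the anomalous dimension is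
measured and in which multiscale (bubble / susceptibility) bookkeeping operates.

* `criticalTwoPoint_decay_of_boxSum_le` — **Messager–Miracle-Solé transport** (quantitative): a box-sum
  bound `C L^{2-κ}` (`0 < κ ≤ 1`, `L ≥ 1`) gives `⟨σ₀σ_x⟩⁺_{β_c(3)} ≤ (27C + 4) ‖x‖^{-(1+κ)}` for `x ≠ 0`:
  average the MMS comparison `⟨σ₀σ_x⟩ ≤ ⟨σ₀σ_y⟩` (`3‖y‖_∞ ≤ ‖x‖_∞`) over `Λ_{⌊‖x‖/3⌋}`.
* `boxSum_le_of_criticalTwoPoint_decay` — **shell sum** (quantitative): a pointwise bound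
  `C ‖x‖^{-(1+κ)}` (`0 < κ ≤ 1`) gives `Σ_{Λ_L} ≤ 1 + 54 C L^{2-κ}` (`|∂Λ_{k+1}| ≤ 6(2k+3)² ≤ 54(k+1)²`).
* `EtaPositive_of_boxSum_gain`, `boxSum_gain_of_EtaPositive`, `EtaPositive_iff_boxSum_gain` — the
  equivalence with the route decl BY NAME (exponents `κ > 1` are first cut down to `min κ 1`).
* `EtaPositive_iff_axis_gain` — the one-parameter (axis) form: `EtaPositive ⟺ ∃ κ > 0, C, ∀ m ≥ 1,
  ⟨σ₀σ_{m e₁}⟩⁺_{β_c(3)} ≤ C m^{-(1+κ)}` (MMS sphere sandwich `criticalTwoPoint_axis_sandwich`).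

No named fact is assumed (standard axioms); tree inputs: `card_box_mul_twoPointPlus_le_sum_box`
(MMS averaged, `TwoPointSupNormMonotone`), `card_box`, `card_sphere_succ_le`, `sum_box_eq_sum_sphere`,
`sphere_zero`, `twoPointPlus_le_one_of_nonneg`, `criticalTwoPoint_axis_sandwich`, `norm_single_axis`.
-/

noncomputable section

namespace Summit.CriticalPhenomena.Ising3DConformalLimit.AnomalousForcesInteractionEtaPositive

open Finset Literature.Probability.LatticeModels

/-- For `x ≠ 0` in `ℤ³`, `‖x‖ = ‖x‖_∞ ≥ 1` as a real number, and `‖x‖ = (Site.supNorm x : ℝ)`. -/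
theorem norm_eq_supNorm_and_one_le {x : Site 3} (hx : x ≠ 0) :
    (‖x‖ : ℝ) = (Site.supNorm x : ℝ) ∧ (1 : ℝ) ≤ (Site.supNorm x : ℝ) := by
  refine ⟨Site.norm_eq_supNorm x, ?_⟩
  have h0 : Site.supNorm x ≠ 0 := fun h => hx (Site.supNorm_eq_zero_iff.1 h)
  exact_mod_cast Nat.one_le_iff_ne_zero.2 h0

/-- **MMS transport, quantitative.** If the box sums of the critical two-point function of the
nearest-neighbour Ising model on `ℤ³` obey `Σ_{y ∈ Λ_L} ⟨σ₀σ_y⟩⁺_{β_c} ≤ C L^{2-κ}` for all `L ≥ 1`, with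
`0 < κ ≤ 1` and `C ≥ 0`, then `⟨σ₀σ_x⟩⁺_{β_c} ≤ (27C + 4) ‖x‖^{-(1+κ)}` for every `x ≠ 0` (sup norm).
Proof: for `n = ‖x‖_∞ ≥ 3` and `R = ⌊n/3⌋`, Messager–Miracle-Solé gives `|Λ_R| ⟨σ₀σ_x⟩ ≤ Σ_{Λ_R} ≤ C R^{2-κ}`
with `|Λ_R| = (2R+1)³ ≥ n³/27`; for `n ≤ 2`, `⟨σ₀σ_x⟩ ≤ 1 ≤ 4 n^{-(1+κ)}`. -/
theorem criticalTwoPoint_decay_of_boxSum_le {κ C : ℝ} (hκ0 : 0 < κ) (hκ1 : κ ≤ 1) (hC : 0 ≤ C)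
    (h : ∀ L : ℕ, 1 ≤ L → ∑ y ∈ box 3 L, criticalTwoPoint 3 y ≤ C * (L : ℝ) ^ (2 - κ)) :
    ∀ x : Site 3, x ≠ 0 → criticalTwoPoint 3 x ≤ (27 * C + 4) * (‖x‖ : ℝ) ^ (-(1 + κ)) := by
  intro x hx
  obtain ⟨hnorm, hn1⟩ := norm_eq_supNorm_and_one_le hx
  set n : ℕ := Site.supNorm x with hndef
  have hn0 : (0 : ℝ) < n := by linarith
  have hG1 : criticalTwoPoint 3 x ≤ 1 := twoPointPlus_le_one_of_nonneg (criticalBeta_nonneg 3) x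
  have hG0 : 0 ≤ criticalTwoPoint 3 x := twoPointPlus_nonneg_of_gks (criticalBeta_nonneg 3) x
  have ht0 : 0 < (n : ℝ) ^ (-(1 + κ)) := Real.rpow_pos_of_pos hn0 _
  rw [hnorm]
  by_cases h3 : 3 ≤ n
  · -- MAIN CASE `n ≥ 3`: MMS averaged over `Λ_R`, `R = ⌊n/3⌋ ≥ 1`
    set R : ℕ := n / 3 with hRdef
    have hR1 : 1 ≤ R := by omega
    have h3R : 3 * R ≤ Site.supNorm x := by rw [← hndef]; omega
    have hMMS : (#(box 3 R) : ℝ) * twoPointPlus 3 (criticalBeta 3) x ≤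
        ∑ y ∈ box 3 R, twoPointPlus 3 (criticalBeta 3) y :=
      card_box_mul_twoPointPlus_le_sum_box (d := 3) (criticalBeta_nonneg 3) h3R
    have hcrit : ∀ y : Site 3, criticalTwoPoint 3 y = twoPointPlus 3 (criticalBeta 3) y := fun _ => rfl
    have hbox : ∑ y ∈ box 3 R, criticalTwoPoint 3 y ≤ C * (R : ℝ) ^ (2 - κ) := h R hR1
    have hcard : (#(box 3 R) : ℝ) = (2 * (R : ℝ) + 1) ^ 3 := by
      rw [card_box]; push_cast; ring
    -- `(2R+1)³ ≥ n³/27` and `R ≤ n`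
    have hRn : (R : ℝ) ≤ n := by exact_mod_cast Nat.div_le_self n 3
    have h2R1 : (n : ℝ) / 3 ≤ 2 * (R : ℝ) + 1 := by
      have : n ≤ 6 * R + 3 := by omega
      have : (n : ℝ) ≤ 6 * (R : ℝ) + 3 := by exact_mod_cast this
      linarith
    set P : ℝ := (2 * (R : ℝ) + 1) ^ 3 with hPdef
    have hP0 : 0 < P := by positivity
    have hPn : (n : ℝ) ^ 3 / 27 ≤ P := by
      have h1 : ((n : ℝ) / 3) ^ 3 ≤ (2 * (R : ℝ) + 1) ^ 3 := pow_le_pow_left₀ (by positivity) h2R1 3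
      have h2 : ((n : ℝ) / 3) ^ 3 = (n : ℝ) ^ 3 / 27 := by ring
      rw [hPdef, ← h2]; exact h1
    -- `P G(x) ≤ C R^{2-κ} ≤ C n^{2-κ}`
    have hRpow : (R : ℝ) ^ (2 - κ) ≤ (n : ℝ) ^ (2 - κ) :=
      Real.rpow_le_rpow (Nat.cast_nonneg R) hRn (by linarith)
    have hPG : P * criticalTwoPoint 3 x ≤ C * (n : ℝ) ^ (2 - κ) := by
      have h1 : P * criticalTwoPoint 3 x ≤ ∑ y ∈ box 3 R, criticalTwoPoint 3 y := by
        rw [← hcard]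
        exact hMMS
      exact h1.trans (hbox.trans (mul_le_mul_of_nonneg_left hRpow hC))
    -- divide by `P ≥ n³/27`
    have hG : criticalTwoPoint 3 x ≤ C * (n : ℝ) ^ (2 - κ) * (27 / (n : ℝ) ^ 3) := by
      have h1 : criticalTwoPoint 3 x ≤ C * (n : ℝ) ^ (2 - κ) / P := by
        rw [le_div_iff₀ hP0]; linarith
      have h2 : C * (n : ℝ) ^ (2 - κ) / P ≤ C * (n : ℝ) ^ (2 - κ) * (27 / (n : ℝ) ^ 3) := by
        rw [div_eq_mul_inv]
        refine mul_le_mul_of_nonneg_left ?_ (by positivity)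
        have := inv_anti₀ (by positivity : (0 : ℝ) < (n : ℝ) ^ 3 / 27) hPn
        rwa [inv_div] at this
      exact h1.trans h2
    -- exponent bookkeeping `n^{2-κ} · n^{-3} = n^{-(1+κ)}`
    have hpow : (n : ℝ) ^ (2 - κ) * (27 / (n : ℝ) ^ 3) = 27 * (n : ℝ) ^ (-(1 + κ)) := by
      have hn3 : (n : ℝ) ^ 3 = (n : ℝ) ^ (3 : ℝ) := by rw [← Real.rpow_natCast]; norm_num
      have hA : (n : ℝ) ^ (2 - κ) * (27 / (n : ℝ) ^ 3) = 27 * ((n : ℝ) ^ (2 - κ) * ((n : ℝ) ^ 3)⁻¹) := by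
        ring
      have hB : ((n : ℝ) ^ 3)⁻¹ = (n : ℝ) ^ (-(3 : ℝ)) := by rw [Real.rpow_neg hn0.le, hn3]
      have hC' : (2 - κ) + -(3 : ℝ) = -(1 + κ) := by ring
      rw [hA, hB, ← Real.rpow_add hn0, hC']
    calc criticalTwoPoint 3 x ≤ C * (n : ℝ) ^ (2 - κ) * (27 / (n : ℝ) ^ 3) := hG
      _ = 27 * C * (n : ℝ) ^ (-(1 + κ)) := by rw [mul_assoc, hpow]; ring
      _ ≤ (27 * C + 4) * (n : ℝ) ^ (-(1 + κ)) := by nlinarith [ht0]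
  · -- SMALL CASE `n ≤ 2`: `G ≤ 1 ≤ 4 n^{-(1+κ)}`
    have hn2 : (n : ℝ) ≤ 2 := by exact_mod_cast (by omega : n ≤ 2)
    have h1 : (2 : ℝ) ^ (-(1 + κ)) ≤ (n : ℝ) ^ (-(1 + κ)) :=
      Real.rpow_le_rpow_of_nonpos hn0 hn2 (by linarith)
    have h2 : (1 / 4 : ℝ) ≤ (2 : ℝ) ^ (-(1 + κ)) := by
      rw [Real.rpow_neg (by norm_num : (0 : ℝ) ≤ 2), ← one_div]
      have h4 : (2 : ℝ) ^ (1 + κ) ≤ 4 :=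
        calc (2 : ℝ) ^ (1 + κ) ≤ (2 : ℝ) ^ ((2 : ℕ) : ℝ) :=
              Real.rpow_le_rpow_of_exponent_le (by norm_num) (by push_cast; linarith)
          _ = 4 := by rw [Real.rpow_natCast]; norm_num
      have hpos : 0 < (2 : ℝ) ^ (1 + κ) := Real.rpow_pos_of_pos (by norm_num) _
      exact one_div_le_one_div_of_le hpos h4
    have h4 : (1 : ℝ) ≤ 4 * (n : ℝ) ^ (-(1 + κ)) := by linarith
    calc criticalTwoPoint 3 x ≤ 1 := hG1
      _ ≤ 4 * (n : ℝ) ^ (-(1 + κ)) := h4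
      _ ≤ (27 * C + 4) * (n : ℝ) ^ (-(1 + κ)) := by nlinarith [ht0]

/-- **The crux `EtaPositive` from a finite-size-scaling gain on the susceptibility** (MMS transport):
if `Σ_{y ∈ Λ_L} ⟨σ₀σ_y⟩⁺_{β_c(3)} ≤ C L^{2-κ}` for all `L ≥ 1` with SOME `κ > 0` ("`χ_L(β_c) ≲ L^{2-η}`, `η > 0`"),
then `Summit.CriticalPhenomena.Ising3DConformalLimit.Theses.AnomalousForcesInteraction.EtaPositive` holds
(with exponent `min κ 1`). Registered stub of stmt-CriticalPhenomena-2600 (verbatim one-line header). -/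
theorem EtaPositive_of_boxSum_gain : (∃ κ C : ℝ, 0 < κ ∧ ∀ L : ℕ, 1 ≤ L → ∑ y ∈ Literature.Probability.LatticeModels.box 3 L, Literature.Probability.LatticeModels.criticalTwoPoint 3 y ≤ C * (L : ℝ) ^ (2 - κ)) → Summit.CriticalPhenomena.Ising3DConformalLimit.Theses.AnomalousForcesInteraction.EtaPositive := by
  intro h
  unfold Summit.CriticalPhenomena.Ising3DConformalLimit.Theses.AnomalousForcesInteraction.EtaPositive
  obtain ⟨κ, C, hκ, hL⟩ := h
  -- cut the exponent down to `κ' = min κ 1 ∈ (0,1]` and the constant up to `C' = max C 0`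
  set κ' : ℝ := min κ 1 with hκ'def
  have hκ'0 : 0 < κ' := lt_min hκ one_pos
  have hκ'1 : κ' ≤ 1 := min_le_right _ _
  have hκ'κ : κ' ≤ κ := min_le_left _ _
  set C' : ℝ := max C 0 with hC'def
  have hC'0 : 0 ≤ C' := le_max_right _ _
  have hL' : ∀ L : ℕ, 1 ≤ L → ∑ y ∈ box 3 L, criticalTwoPoint 3 y ≤ C' * (L : ℝ) ^ (2 - κ') := by
    intro L hL1
    have hL1' : (1 : ℝ) ≤ L := by exact_mod_cast hL1
    have hp0 : 0 ≤ (L : ℝ) ^ (2 - κ) := Real.rpow_nonneg (by linarith) _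
    calc ∑ y ∈ box 3 L, criticalTwoPoint 3 y ≤ C * (L : ℝ) ^ (2 - κ) := hL L hL1
      _ ≤ C' * (L : ℝ) ^ (2 - κ) := mul_le_mul_of_nonneg_right (le_max_left _ _) hp0
      _ ≤ C' * (L : ℝ) ^ (2 - κ') :=
        mul_le_mul_of_nonneg_left (Real.rpow_le_rpow_of_exponent_le hL1' (by linarith)) hC'0
  exact ⟨κ', 27 * C' + 4, hκ'0, criticalTwoPoint_decay_of_boxSum_le hκ'0 hκ'1 hC'0 hL'⟩

/-- **Shell sum, quantitative.** If `⟨σ₀σ_x⟩⁺_{β_c(3)} ≤ C ‖x‖^{-(1+κ)}` for all `x ≠ 0`, with `0 < κ ≤ 1` and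
`C ≥ 0` (only `κ ≤ 1` is used), then for every `L`, `Σ_{y ∈ Λ_L} ⟨σ₀σ_y⟩⁺_{β_c(3)} ≤ 1 + 54 C L^{2-κ}` (decompose
`Λ_L` into the shells `∂Λ_{k+1}`, `k < L`, of cardinality `≤ 6(2k+3)² ≤ 54(k+1)²`, bound each by
`54 C (k+1)^{1-κ} ≤ 54 C L^{1-κ}`, and `⟨σ₀σ₀⟩ ≤ 1`). -/
theorem boxSum_le_of_criticalTwoPoint_decay {κ C : ℝ} (hκ1 : κ ≤ 1) (hC : 0 ≤ C)
    (h : ∀ x : Site 3, x ≠ 0 → criticalTwoPoint 3 x ≤ C * (‖x‖ : ℝ) ^ (-(1 + κ))) (L : ℕ) :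
    ∑ y ∈ box 3 L, criticalTwoPoint 3 y ≤ 1 + 54 * C * (L : ℝ) ^ (2 - κ) := by
  -- one shell
  have hshell : ∀ k : ℕ, k < L →
      ∑ v ∈ sphere 3 (k + 1), criticalTwoPoint 3 v ≤ 54 * C * (L : ℝ) ^ (1 - κ) := by
    intro k hk
    have hk1 : (0 : ℝ) < (k : ℝ) + 1 := by positivity
    have hkL : (k : ℝ) + 1 ≤ L := by exact_mod_cast hk
    have hpt : ∀ v ∈ sphere 3 (k + 1), criticalTwoPoint 3 v ≤ C * ((k : ℝ) + 1) ^ (-(1 + κ)) := by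
      intro v hv
      have hvn : Site.supNorm v = k + 1 := mem_sphere.1 hv
      have hv0 : v ≠ 0 := fun h0 => by rw [h0, Site.supNorm_eq_zero_iff.2 rfl] at hvn; omega
      have hnorm : (‖v‖ : ℝ) = (k : ℝ) + 1 := by
        rw [Site.norm_eq_supNorm, hvn]; push_cast; ring
      have := h v hv0
      rwa [hnorm] at this
    have hexp : ((k : ℝ) + 1) ^ 2 * ((k : ℝ) + 1) ^ (-(1 + κ)) = ((k : ℝ) + 1) ^ (1 - κ) := by
      have h2 : ((k : ℝ) + 1) ^ 2 = ((k : ℝ) + 1) ^ (2 : ℝ) := by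
        rw [← Real.rpow_natCast]; norm_num
      rw [h2, ← Real.rpow_add hk1]
      congr 1; ring
    have hmono : ((k : ℝ) + 1) ^ (1 - κ) ≤ (L : ℝ) ^ (1 - κ) :=
      Real.rpow_le_rpow hk1.le hkL (by linarith)
    calc ∑ v ∈ sphere 3 (k + 1), criticalTwoPoint 3 v
        ≤ ∑ _v ∈ sphere 3 (k + 1), C * ((k : ℝ) + 1) ^ (-(1 + κ)) := Finset.sum_le_sum hpt
      _ = (#(sphere 3 (k + 1)) : ℝ) * (C * ((k : ℝ) + 1) ^ (-(1 + κ))) := by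
          rw [Finset.sum_const, nsmul_eq_mul]
      _ ≤ (2 * (3 : ℕ) * (2 * k + 3 : ℝ) ^ (3 - 1)) * (C * ((k : ℝ) + 1) ^ (-(1 + κ))) := by
          gcongr
          exact card_sphere_succ_le k
      _ ≤ (6 * (3 * ((k : ℝ) + 1)) ^ 2) * (C * ((k : ℝ) + 1) ^ (-(1 + κ))) := by
          gcongr
          · norm_num
          · linarith
      _ = 54 * C * (((k : ℝ) + 1) ^ 2 * ((k : ℝ) + 1) ^ (-(1 + κ))) := by ring
      _ = 54 * C * ((k : ℝ) + 1) ^ (1 - κ) := by rw [hexp]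
      _ ≤ 54 * C * (L : ℝ) ^ (1 - κ) := by gcongr
  have hzero : ∑ v ∈ sphere 3 0, criticalTwoPoint 3 v ≤ 1 := by
    rw [sphere_zero, Finset.sum_singleton]
    exact twoPointPlus_le_one_of_nonneg (criticalBeta_nonneg 3) 0
  rw [sum_box_eq_sum_sphere, Finset.sum_range_succ']
  have hL0 : (0 : ℝ) ≤ L := Nat.cast_nonneg L
  calc ∑ k ∈ Finset.range L, ∑ v ∈ sphere 3 (k + 1), criticalTwoPoint 3 v
          + ∑ v ∈ sphere 3 0, criticalTwoPoint 3 v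
      ≤ ∑ _k ∈ Finset.range L, 54 * C * (L : ℝ) ^ (1 - κ) + 1 := by
        gcongr with k hk
        exact hshell k (Finset.mem_range.1 hk)
    _ = (L : ℝ) * (54 * C * (L : ℝ) ^ (1 - κ)) + 1 := by
        rw [Finset.sum_const, Finset.card_range, nsmul_eq_mul]
    _ = 1 + 54 * C * ((L : ℝ) * (L : ℝ) ^ (1 - κ)) := by ring
    _ = 1 + 54 * C * (L : ℝ) ^ (2 - κ) := by
        rcases Nat.eq_zero_or_pos L with hL | hL
        · subst hL
          simp [Real.zero_rpow (show (2 : ℝ) - κ ≠ 0 by linarith)]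
        · have hL' : (0 : ℝ) < L := by exact_mod_cast hL
          rw [← Real.rpow_one_add' hL'.le (by linarith)]
          congr 2; ring

/-- **A finite-size-scaling gain on the susceptibility from the crux `EtaPositive`** (shell sum): `EtaPositive`
implies `Σ_{y ∈ Λ_L} ⟨σ₀σ_y⟩⁺_{β_c(3)} ≤ C L^{2-κ}` for all `L ≥ 1`, for some `κ > 0` (namely `min κ 1`) and `C`. -/
theorem boxSum_gain_of_EtaPositive
    (h : Summit.CriticalPhenomena.Ising3DConformalLimit.Theses.AnomalousForcesInteraction.EtaPositive) :
    ∃ κ C : ℝ, 0 < κ ∧ ∀ L : ℕ, 1 ≤ L →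
      ∑ y ∈ box 3 L, criticalTwoPoint 3 y ≤ C * (L : ℝ) ^ (2 - κ) := by
  unfold Summit.CriticalPhenomena.Ising3DConformalLimit.Theses.AnomalousForcesInteraction.EtaPositive at h
  obtain ⟨κ, C, hκ, hx⟩ := h
  set κ' : ℝ := min κ 1 with hκ'def
  have hκ'0 : 0 < κ' := lt_min hκ one_pos
  have hκ'1 : κ' ≤ 1 := min_le_right _ _
  have hκ'κ : κ' ≤ κ := min_le_left _ _
  set C' : ℝ := max C 0 with hC'def
  have hC'0 : 0 ≤ C' := le_max_right _ _
  -- pointwise bound with the smaller exponent and the non-negative constant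
  have hx' : ∀ x : Site 3, x ≠ 0 → criticalTwoPoint 3 x ≤ C' * (‖x‖ : ℝ) ^ (-(1 + κ')) := by
    intro x hx0
    obtain ⟨hnorm, hn1⟩ := norm_eq_supNorm_and_one_le hx0
    have hp0 : 0 ≤ (‖x‖ : ℝ) ^ (-(1 + κ)) := Real.rpow_nonneg (norm_nonneg _) _
    have hn1' : (1 : ℝ) ≤ ‖x‖ := by rw [hnorm]; exact hn1
    calc criticalTwoPoint 3 x ≤ C * (‖x‖ : ℝ) ^ (-(1 + κ)) := hx x hx0
      _ ≤ C' * (‖x‖ : ℝ) ^ (-(1 + κ)) := mul_le_mul_of_nonneg_right (le_max_left _ _) hp0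
      _ ≤ C' * (‖x‖ : ℝ) ^ (-(1 + κ')) :=
        mul_le_mul_of_nonneg_left (Real.rpow_le_rpow_of_exponent_le hn1' (by linarith)) hC'0
  refine ⟨κ', 1 + 54 * C', hκ'0, fun L hL1 => ?_⟩
  have hL1' : (1 : ℝ) ≤ L := by exact_mod_cast hL1
  have hp1 : (1 : ℝ) ≤ (L : ℝ) ^ (2 - κ') := Real.one_le_rpow hL1' (by linarith)
  have hp0 : (0 : ℝ) ≤ (L : ℝ) ^ (2 - κ') := by linarith
  calc ∑ y ∈ box 3 L, criticalTwoPoint 3 y ≤ 1 + 54 * C' * (L : ℝ) ^ (2 - κ') :=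
        boxSum_le_of_criticalTwoPoint_decay hκ'1 hC'0 hx' L
    _ ≤ (1 + 54 * C') * (L : ℝ) ^ (2 - κ') := by nlinarith

/-- **`η(3) > 0` in power form ⟺ a finite-size-scaling gain on the critical susceptibility.** The crux
`EtaPositive` of route `AnomalousForcesInteraction` is equivalent to: for some `κ > 0` and `C`,
`Σ_{y ∈ Λ_L} ⟨σ₀σ_y⟩⁺_{β_c(3)} ≤ C L^{2-κ}` for every `L ≥ 1` — a strict power improvement of the infrared growth
`χ_L(β_c) ≲ L²` of the box sums of the infinite-volume critical two-point function (Messager–Miracle-Solé one way,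
shell counting the other). Registered stub of stmt-CriticalPhenomena-2600 (verbatim one-line header). -/
theorem EtaPositive_iff_boxSum_gain : Summit.CriticalPhenomena.Ising3DConformalLimit.Theses.AnomalousForcesInteraction.EtaPositive ↔ ∃ κ C : ℝ, 0 < κ ∧ ∀ L : ℕ, 1 ≤ L → ∑ y ∈ Literature.Probability.LatticeModels.box 3 L, Literature.Probability.LatticeModels.criticalTwoPoint 3 y ≤ C * (L : ℝ) ^ (2 - κ) :=
  ⟨boxSum_gain_of_EtaPositive, EtaPositive_of_boxSum_gain⟩

/-- **`η(3) > 0` in power form ⟺ a power gain along ONE axis sequence.** The crux `EtaPositive` is equivalent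
to: for some `κ > 0` and `C`, `⟨σ₀σ_{m e₁}⟩⁺_{β_c(3)} ≤ C m^{-(1+κ)}` for every `m ≥ 1` — the one-parameter
(axis) form, by the Messager–Miracle-Solé sphere sandwich `⟨σ₀σ_y⟩ ≤ ⟨σ₀σ_{‖y‖_∞ e₁}⟩`
(`criticalTwoPoint_axis_sandwich`); the axis sequence is moreover antitone (`criticalTwoPoint_axis_antitone`).
Registered stub of stmt-CriticalPhenomena-2600 (verbatim one-line header). -/
theorem EtaPositive_iff_axis_gain : Summit.CriticalPhenomena.Ising3DConformalLimit.Theses.AnomalousForcesInteraction.EtaPositive ↔ ∃ κ C : ℝ, 0 < κ ∧ ∀ m : ℕ, 1 ≤ m → Literature.Probability.LatticeModels.criticalTwoPoint 3 (Pi.single 0 (m : ℤ)) ≤ C * (m : ℝ) ^ (-(1 + κ)) := by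
  unfold Summit.CriticalPhenomena.Ising3DConformalLimit.Theses.AnomalousForcesInteraction.EtaPositive
  constructor
  · rintro ⟨κ, C, hκ, h⟩
    refine ⟨κ, C, hκ, fun m hm => ?_⟩
    have hx : (Pi.single 0 (m : ℤ) : Site 3) ≠ 0 := by
      intro h0
      have h00 := congrFun h0 0
      simp only [Pi.single_eq_same, Pi.zero_apply, Nat.cast_eq_zero] at h00
      omega
    have key := h _ hx
    rwa [norm_single_axis, Int.cast_natCast, abs_of_nonneg (Nat.cast_nonneg m)] at key
  · rintro ⟨κ, C, hκ, h⟩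
    refine ⟨κ, C, hκ, fun y hy => ?_⟩
    have hn1 : 1 ≤ Site.supNorm y :=
      Nat.one_le_iff_ne_zero.2 fun h0 => hy (Site.supNorm_eq_zero_iff.1 h0)
    rw [Site.norm_eq_supNorm]
    exact (criticalTwoPoint_axis_sandwich hn1).2.trans (h (Site.supNorm y) hn1)

end Summit.CriticalPhenomena.Ising3DConformalLimit.AnomalousForcesInteractionEtaPositive
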